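import Mathlib
import Literature.AlgebraicGeometry.Resolution.QuadraticTransforms
import Literature.AlgebraicGeometry.Resolution.RegularLocalRingsProofs
import HarnessLib

/-!
# Crux `Steer` (stmt-ResolutionOfSingularities-16345), chain W4.1, R2 σ_top line: **K(2) realisation layer,
# base lemmas** — the radicand ring `S[θ]/(θ^p − f)` over a local domain of characteristic `p`

OURS (campaign `res-hironaka`, rung L ★L-G4, slot W4.1; seat `res-L1-type-o8` = `res-D-pv-015`, SPLIT of
res-L0-w41-plan-1's ORDER 05:10:18Z «K(2) from `Lipman1978NoEternalNormalBranch`» held by res-type-026: this seat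
supplies the REALISATION LAYER — the radicand rings of an isolated radicand chain realised as a chain of quadratic
transforms of local subrings of ONE field — and res-type-026 keeps normality + the contradiction).  Not a statement
of the manuscript under review; AI review is weaker than expert review.

This file: two base lemmas about the radicand ring `T := AdjoinRoot (X ^ p - C f)` of an element `f` of a local
domain `S` of prime characteristic `p`.

* `isLocalRing_adjoinRoot` / `maximalIdeal_adjoinRoot_eq` / `comap_maximalIdeal_adjoinRoot` — if `f ≡ h ^ p`
  modulo the maximal ideal `𝔪` of `S`, then `T` is LOCAL with maximal ideal `(θ − h) + 𝔪 T` lying over `𝔪`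
  (every maximal ideal of the integral extension `T ⊇ S` contracts to `𝔪`, hence contains `(θ − h)^p = f − h^p`,
  hence `θ − h`; and `P(θ) ≡ P(h)` modulo `θ − h`).
* `pow_ne_of_isolated` — if `S ⊆ L` is a subring of a field which is NOT a field and every non-maximal prime `P`
  of `T` has `T_P` regular («isolated singularity»), then `f` is not the `p`-th power of a fraction `u / v`,
  `u, v ∈ S`: otherwise `v θ − u` is a non-zero nilpotent of `T` killed in the regular (hence reduced) local ring
  `T_P` at the NON-maximal prime `P = ker (θ ↦ u/v)`, and chasing the annihilator through `L[X]`, where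
  `X ^ p - f = (X - u/v) ^ p`, puts it inside `P` — a contradiction.
[folklore]
-/

noncomputable section

-- `Summit.<S>.<S>.…` duplicates the summit name by design (single-problem summit).
set_option linter.dupNamespace false

open Polynomial IsLocalRing

namespace Summit.ResolutionOfSingularities.ResolutionOfSingularities.Theorems.SwitchingDichotomy

namespace RadicandChainRealisation

/-! ## (0) Generalities on the radicand polynomial `X ^ p - C f` -/

section General

variable {S : Type*} [CommRing S] {p : ℕ}

/-- In the radicand ring, `θ ^ p = f`. [folklore] -/
theorem root_pow_eq (f : S) :
    AdjoinRoot.root ((X : S[X]) ^ p - C f) ^ p = AdjoinRoot.of ((X : S[X]) ^ p - C f) f := by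
  have h := AdjoinRoot.eval₂_root ((X : S[X]) ^ p - C f)
  rw [eval₂_sub, eval₂_X_pow, eval₂_C, sub_eq_zero] at h
  exact h

/-- For every polynomial `P`, `P(θ) − P(h)` is a multiple of `θ − h` in the radicand ring. [folklore] -/
theorem mk_sub_of_eval_mem_span (f h : S) (P : S[X]) :
    AdjoinRoot.mk ((X : S[X]) ^ p - C f) P - AdjoinRoot.of ((X : S[X]) ^ p - C f) (P.eval h) ∈
      Ideal.span {AdjoinRoot.root ((X : S[X]) ^ p - C f) - AdjoinRoot.of ((X : S[X]) ^ p - C f) h} := by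
  rw [Ideal.mem_span_singleton]
  have hd : X - C h ∣ P - C (P.eval h) := X_sub_C_dvd_sub_C_eval
  have := map_dvd (AdjoinRoot.mk ((X : S[X]) ^ p - C f)) hd
  simpa [AdjoinRoot.mk_X, AdjoinRoot.mk_C] using this

variable [hp : Fact p.Prime]

/-- The radicand polynomial `X ^ p - C f` is monic. [folklore] -/
theorem monic_X_pow_sub_C' (f : S) : ((X : S[X]) ^ p - C f).Monic :=
  monic_X_pow_sub_C f hp.out.ne_zero

/-- The radicand polynomial has non-zero degree (over a nontrivial ring). [folklore] -/
theorem degree_X_pow_sub_C_ne_zero [Nontrivial S] (f : S) : ((X : S[X]) ^ p - C f).degree ≠ 0 := by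
  rw [degree_X_pow_sub_C hp.out.pos]
  exact_mod_cast hp.out.ne_zero

/-- Over a domain, `S` embeds in the radicand ring. [folklore] -/
theorem of_injective [IsDomain S] (f : S) : Function.Injective (AdjoinRoot.of ((X : S[X]) ^ p - C f)) :=
  AdjoinRoot.of.injective_of_degree_ne_zero (degree_X_pow_sub_C_ne_zero f)

/-- Over a domain of characteristic `p`, the radicand ring has characteristic `p`. [folklore] -/
theorem charP_adjoinRoot [IsDomain S] [CharP S p] (f : S) : CharP (AdjoinRoot ((X : S[X]) ^ p - C f)) p :=
  charP_of_injective_algebraMap (R := S) (by rw [AdjoinRoot.algebraMap_eq]; exact of_injective f) p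

/-- The radicand ring is a finite `S`-module. [folklore] -/
theorem finite_adjoinRoot (f : S) : Module.Finite S (AdjoinRoot ((X : S[X]) ^ p - C f)) :=
  (monic_X_pow_sub_C' f).finite_adjoinRoot

/-- The radicand ring is integral over `S`. [folklore] -/
theorem isIntegral_adjoinRoot (f : S) : Algebra.IsIntegral S (AdjoinRoot ((X : S[X]) ^ p - C f)) :=
  haveI := finite_adjoinRoot (p := p) f
  Algebra.IsIntegral.of_finite S _

end General

/-! ## (1) The radicand ring over a local domain of characteristic `p` is local -/

section Local

variable {S : Type*} [CommRing S] [IsDomain S] [IsLocalRing S] {p : ℕ} [hp : Fact p.Prime] [CharP S p]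

/-- Every maximal ideal of the radicand ring `T = S[θ]/(θ^p − f)`, `f ≡ h^p (mod 𝔪_S)`, equals
`(θ − h) + 𝔪_S T`. [folklore] -/
theorem eq_of_isMaximal_adjoinRoot (f h : S) (hfh : f - h ^ p ∈ maximalIdeal S)
    (N : Ideal (AdjoinRoot ((X : S[X]) ^ p - C f))) (hN : N.IsMaximal) :
    N = Ideal.span {AdjoinRoot.root ((X : S[X]) ^ p - C f) - AdjoinRoot.of ((X : S[X]) ^ p - C f) h} ⊔
      (maximalIdeal S).map (AdjoinRoot.of ((X : S[X]) ^ p - C f)) := by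
  haveI := isIntegral_adjoinRoot (p := p) f
  haveI := charP_adjoinRoot (p := p) f
  haveI := hN
  -- the contraction of `N` is the maximal ideal of `S`
  have hcomap : N.comap (AdjoinRoot.of ((X : S[X]) ^ p - C f)) = maximalIdeal S := by
    have := eq_maximalIdeal (Ideal.isMaximal_comap_of_isIntegral_of_isMaximal (R := S) N)
    rwa [AdjoinRoot.algebraMap_eq] at this
  -- `θ - h ∈ N`
  have hroot : AdjoinRoot.root ((X : S[X]) ^ p - C f) - AdjoinRoot.of ((X : S[X]) ^ p - C f) h ∈ N := by
    apply hN.isPrime.mem_of_pow_mem p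
    rw [sub_pow_char, root_pow_eq, ← map_pow, ← map_sub]
    have : f - h ^ p ∈ N.comap (AdjoinRoot.of ((X : S[X]) ^ p - C f)) := by rw [hcomap]; exact hfh
    exact this
  have hspan : Ideal.span {AdjoinRoot.root ((X : S[X]) ^ p - C f) - AdjoinRoot.of ((X : S[X]) ^ p - C f) h}
      ≤ N := Ideal.span_le.mpr (Set.singleton_subset_iff.mpr hroot)
  apply le_antisymm
  · intro t ht
    obtain ⟨P, rfl⟩ := AdjoinRoot.mk_surjective t
    have h1 := mk_sub_of_eval_mem_span (p := p) f h P
    have h2 : AdjoinRoot.of ((X : S[X]) ^ p - C f) (P.eval h) ∈ N := by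
      have := N.sub_mem ht (hspan h1)
      simpa using this
    have h3 : P.eval h ∈ maximalIdeal S := by
      rw [← hcomap]; exact h2
    have : AdjoinRoot.mk ((X : S[X]) ^ p - C f) P =
        (AdjoinRoot.mk ((X : S[X]) ^ p - C f) P - AdjoinRoot.of ((X : S[X]) ^ p - C f) (P.eval h)) +
          AdjoinRoot.of ((X : S[X]) ^ p - C f) (P.eval h) := by ring
    rw [this]
    exact Ideal.add_mem _ (Ideal.mem_sup_left h1) (Ideal.mem_sup_right (Ideal.mem_map_of_mem _ h3))
  · refine sup_le hspan ?_
    rw [Ideal.map_le_iff_le_comap, hcomap]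

/-- **The radicand ring of `f ≡ h^p (mod 𝔪)` over a local domain of characteristic `p` is local.**
[folklore] -/
theorem isLocalRing_adjoinRoot (f h : S) (hfh : f - h ^ p ∈ maximalIdeal S) :
    IsLocalRing (AdjoinRoot ((X : S[X]) ^ p - C f)) := by
  haveI : Nontrivial (AdjoinRoot ((X : S[X]) ^ p - C f)) :=
    AdjoinRoot.nontrivial _ (degree_X_pow_sub_C_ne_zero f)
  obtain ⟨N, hN⟩ := Ideal.exists_maximal (AdjoinRoot ((X : S[X]) ^ p - C f))
  refine of_unique_max_ideal ⟨N, hN, fun I hI => ?_⟩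
  rw [eq_of_isMaximal_adjoinRoot f h hfh I hI, eq_of_isMaximal_adjoinRoot f h hfh N hN]

/-- The maximal ideal of the (local) radicand ring is `(θ − h) + 𝔪_S T`. [folklore] -/
theorem maximalIdeal_adjoinRoot_eq (f h : S) (hfh : f - h ^ p ∈ maximalIdeal S)
    [IsLocalRing (AdjoinRoot ((X : S[X]) ^ p - C f))] :
    maximalIdeal (AdjoinRoot ((X : S[X]) ^ p - C f)) =
      Ideal.span {AdjoinRoot.root ((X : S[X]) ^ p - C f) - AdjoinRoot.of ((X : S[X]) ^ p - C f) h} ⊔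
        (maximalIdeal S).map (AdjoinRoot.of ((X : S[X]) ^ p - C f)) :=
  eq_of_isMaximal_adjoinRoot f h hfh _ inferInstance

omit [IsDomain S] [CharP S p] in
/-- The maximal ideal of the radicand ring lies over the maximal ideal of `S`. [folklore] -/
theorem comap_maximalIdeal_adjoinRoot (f : S) [IsLocalRing (AdjoinRoot ((X : S[X]) ^ p - C f))] :
    (maximalIdeal (AdjoinRoot ((X : S[X]) ^ p - C f))).comap (AdjoinRoot.of ((X : S[X]) ^ p - C f)) =
      maximalIdeal S := by
  haveI := isIntegral_adjoinRoot (p := p) f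
  have := eq_maximalIdeal
    (Ideal.isMaximal_comap_of_isIntegral_of_isMaximal (R := S) (maximalIdeal (AdjoinRoot ((X : S[X]) ^ p - C f))))
  rwa [AdjoinRoot.algebraMap_eq] at this

/-- `θ − g` lies in the maximal ideal of the radicand ring whenever `f ≡ g ^ p (mod 𝔪_S)`. [folklore] -/
theorem root_sub_of_mem_maximalIdeal (f g : S) (hfg : f - g ^ p ∈ maximalIdeal S)
    [IsLocalRing (AdjoinRoot ((X : S[X]) ^ p - C f))] :
    AdjoinRoot.root ((X : S[X]) ^ p - C f) - AdjoinRoot.of ((X : S[X]) ^ p - C f) g ∈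
      maximalIdeal (AdjoinRoot ((X : S[X]) ^ p - C f)) := by
  rw [maximalIdeal_adjoinRoot_eq f g hfg]
  exact Ideal.mem_sup_left (Ideal.mem_span_singleton_self _)

omit [IsDomain S] [CharP S p] in
/-- Elements of `𝔪_S` lie in the maximal ideal of the radicand ring. [folklore] -/
theorem of_mem_maximalIdeal (f : S) [IsLocalRing (AdjoinRoot ((X : S[X]) ^ p - C f))] {s : S}
    (hs : s ∈ maximalIdeal S) :
    AdjoinRoot.of ((X : S[X]) ^ p - C f) s ∈ maximalIdeal (AdjoinRoot ((X : S[X]) ^ p - C f)) := by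
  have : s ∈ (maximalIdeal (AdjoinRoot ((X : S[X]) ^ p - C f))).comap (AdjoinRoot.of ((X : S[X]) ^ p - C f)) := by
    rw [comap_maximalIdeal_adjoinRoot]; exact hs
  exact this

omit [IsDomain S] [CharP S p] in
/-- Conversely, an element of `S` lying in the maximal ideal of the radicand ring lies in `𝔪_S`. [folklore] -/
theorem mem_maximalIdeal_of_of_mem (f : S) [IsLocalRing (AdjoinRoot ((X : S[X]) ^ p - C f))] {s : S}
    (hs : AdjoinRoot.of ((X : S[X]) ^ p - C f) s ∈ maximalIdeal (AdjoinRoot ((X : S[X]) ^ p - C f))) :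
    s ∈ maximalIdeal S := by
  rw [← comap_maximalIdeal_adjoinRoot (p := p) f]
  exact hs

end Local

/-! ## (2) Isolatedness forbids `p`-th roots of the radicand among the fractions of `S` -/

section NoRoot

variable {L : Type*} [Field L] {p : ℕ} [hp : Fact p.Prime] [CharP L p]

/-- **No `p`-th root of an isolated radicand among fractions.**  Let `S ⊆ L` be a subring of a field of
characteristic `p` which is not a field, `f ∈ S`, and suppose every NON-maximal prime `P` of
`T = S[θ]/(θ^p − f)` has `T_P` regular.  Then `(u/v)^p ≠ f` for all `u, v ∈ S`, `v ≠ 0`. [folklore] -/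
theorem pow_ne_of_isolated (S : Subring L) (hS : ¬ IsField S) (f : S)
    (hisol : ∀ (P : Ideal (AdjoinRoot ((X : S[X]) ^ p - C f))) [P.IsPrime],
      (∃ Q : Ideal (AdjoinRoot ((X : S[X]) ^ p - C f)), Q.IsPrime ∧ P < Q) →
      IsRegularLocalRing (Localization.AtPrime P))
    (u v : S) (hv : v ≠ 0) : ((u : L) / (v : L)) ^ p ≠ (f : L) := by
  intro hb
  have hv' : (v : L) ≠ 0 := fun e => hv (Subtype.ext e)
  -- `u = v b` and `u ^ p = v ^ p f`
  have hub : (u : L) = (v : L) * ((u : L) / (v : L)) := by rw [mul_div_cancel₀ _ hv']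
  -- the evaluation map `θ ↦ b`
  have heval : ((X : S[X]) ^ p - C f).eval₂ S.subtype ((u : L) / (v : L)) = 0 := by
    rw [eval₂_sub, eval₂_X_pow, eval₂_C, hb]; simp
  let ψ : AdjoinRoot ((X : S[X]) ^ p - C f) →+* L := AdjoinRoot.lift S.subtype _ heval
  haveI hPprime : (RingHom.ker ψ).IsPrime := RingHom.ker_isPrime ψ
  -- `ker ψ` is not maximal: `T / ker ψ ⊇ S` is an integral extension of a non-field by a domain
  have hPnotmax : ¬ (RingHom.ker ψ).IsMaximal := by
    intro hmax
    have hfieldQ : IsField (AdjoinRoot ((X : S[X]) ^ p - C f) ⧸ RingHom.ker ψ) :=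
      (Ideal.Quotient.maximal_ideal_iff_isField_quotient _).mp hmax
    haveI := isIntegral_adjoinRoot (p := p) f
    -- the structure map `S → T / ker ψ` is injective: `ψ ∘ of = S.subtype` is injective
    have hcomap : (RingHom.ker ψ).comap (algebraMap S (AdjoinRoot ((X : S[X]) ^ p - C f))) = ⊥ := by
      rw [AdjoinRoot.algebraMap_eq, eq_bot_iff]
      intro s hs
      rw [Ideal.mem_comap, RingHom.mem_ker] at hs
      have : (s : L) = 0 := by simpa [ψ, AdjoinRoot.lift_of] using hs
      exact (Ideal.mem_bot).mpr (Subtype.ext this)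
    haveI : Algebra.IsIntegral (S ⧸ (RingHom.ker ψ).comap (algebraMap S (AdjoinRoot ((X : S[X]) ^ p - C f))))
        (AdjoinRoot ((X : S[X]) ^ p - C f) ⧸ RingHom.ker ψ) := Algebra.IsIntegral.quotient
    haveI : IsDomain (AdjoinRoot ((X : S[X]) ^ p - C f) ⧸ RingHom.ker ψ) :=
      Ideal.Quotient.isDomain _
    have hinj : Function.Injective (algebraMap
        (S ⧸ (RingHom.ker ψ).comap (algebraMap S (AdjoinRoot ((X : S[X]) ^ p - C f))))
        (AdjoinRoot ((X : S[X]) ^ p - C f) ⧸ RingHom.ker ψ)) :=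
      Ideal.algebraMap_quotient_injective
    have hF := (Algebra.IsIntegral.isField_iff_isField hinj).mpr hfieldQ
    -- `S ⧸ ⊥ ≅ S`, so `S` would be a field
    apply hS
    have e : (S ⧸ (RingHom.ker ψ).comap (algebraMap S (AdjoinRoot ((X : S[X]) ^ p - C f)))) ≃+* S :=
      (Ideal.quotEquivOfEq hcomap).trans (RingEquiv.quotientBot S)
    exact MulEquiv.isField hF e.symm.toMulEquiv
  -- hence there is a prime strictly above `ker ψ`, and `T_{ker ψ}` is regular, in particular a domain
  obtain ⟨Q, hQmax, hPQ⟩ := Ideal.exists_le_maximal (RingHom.ker ψ) hPprime.ne_top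
  have hPltQ : RingHom.ker ψ < Q := lt_of_le_of_ne hPQ (fun e => hPnotmax (e ▸ hQmax))
  have hreg : IsRegularLocalRing (Localization.AtPrime (RingHom.ker ψ)) :=
    hisol (RingHom.ker ψ) ⟨Q, hQmax.isPrime, hPltQ⟩
  haveI : IsDomain (Localization.AtPrime (RingHom.ker ψ)) :=
    Literature.AlgebraicGeometry.Resolution.isDomain_of_isRegularLocalRing _
  -- the nilpotent `w = v θ − u`
  have hupow : u ^ p = v ^ p * f := by
    apply Subtype.ext
    have : (u : L) ^ p = (v : L) ^ p * (f : L) := by rw [hub, mul_pow, hb]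
    simpa using this
  haveI := charP_adjoinRoot (p := p) f
  have hwp : (AdjoinRoot.mk ((X : S[X]) ^ p - C f) (C v * X - C u)) ^ p = 0 := by
    rw [← map_pow, AdjoinRoot.mk_eq_zero]
    refine ⟨C (v ^ p), ?_⟩
    rw [sub_pow_char, mul_pow, ← C_pow, ← C_pow, hupow, C_mul]
    ring
  -- it maps to zero in the domain `T_P`, so it is killed by some `s ∉ ker ψ`
  have hw0 : algebraMap _ (Localization.AtPrime (RingHom.ker ψ))
      (AdjoinRoot.mk ((X : S[X]) ^ p - C f) (C v * X - C u)) = 0 := by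
    have : (algebraMap _ (Localization.AtPrime (RingHom.ker ψ))
        (AdjoinRoot.mk ((X : S[X]) ^ p - C f) (C v * X - C u))) ^ p = 0 := by
      rw [← map_pow, hwp, map_zero]
    exact (pow_eq_zero_iff hp.out.ne_zero).mp this
  obtain ⟨⟨s, hs⟩, hsw⟩ := (IsLocalization.map_eq_zero_iff (RingHom.ker ψ).primeCompl _ _).mp hw0
  have hsP : s ∉ RingHom.ker ψ := hs
  simp only at hsw
  -- write `s = mk Ps` and move to `L[X]`, where `X ^ p - f = (X - b)^p` and `v X - u = v (X - b)`
  obtain ⟨Ps, rfl⟩ := AdjoinRoot.mk_surjective s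
  have hdvd : (X : S[X]) ^ p - C f ∣ Ps * (C v * X - C u) := by
    rw [← AdjoinRoot.mk_eq_zero, map_mul]; exact hsw
  obtain ⟨t, ht⟩ := hdvd
  have hmap := congrArg (Polynomial.map S.subtype) ht
  have hqmap : ((X : S[X]) ^ p - C f).map S.subtype = (X - C ((u : L) / (v : L))) ^ p := by
    rw [Polynomial.map_sub, Polynomial.map_pow, map_X, map_C, sub_pow_char, ← C_pow, hb]; rfl
  have hlin : (C v * X - C u : S[X]).map S.subtype = C (v : L) * (X - C ((u : L) / (v : L))) := by
    rw [Polynomial.map_sub, Polynomial.map_mul, map_C, map_X, map_C, mul_sub, ← C_mul, ← hub]; rfl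
  rw [Polynomial.map_mul, Polynomial.map_mul, hlin, hqmap] at hmap
  -- cancel one factor `X - C b`: `(X - C b) ∣ C v * Ps.map`
  have hXb : (X - C ((u : L) / (v : L)) : L[X]) ≠ 0 := X_sub_C_ne_zero _
  have hp1 : p - 1 ≠ 0 := by have := hp.out.two_le; omega
  have hdiv : (X - C ((u : L) / (v : L))) ∣ C (v : L) * Ps.map S.subtype := by
    have h3 : (C (v : L) * Ps.map S.subtype) * (X - C ((u : L) / (v : L))) =
        ((X - C ((u : L) / (v : L))) ^ (p - 1) * t.map S.subtype) * (X - C ((u : L) / (v : L))) := by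
      have h2 : (X - C ((u : L) / (v : L)) : L[X]) ^ p =
          (X - C ((u : L) / (v : L))) ^ (p - 1) * (X - C ((u : L) / (v : L))) := by
        rw [← pow_succ, Nat.sub_add_cancel hp.out.one_lt.le]
      calc (C (v : L) * Ps.map S.subtype) * (X - C ((u : L) / (v : L)))
          = Ps.map S.subtype * (C (v : L) * (X - C ((u : L) / (v : L)))) := by ring
        _ = (X - C ((u : L) / (v : L))) ^ p * t.map S.subtype := hmap
        _ = ((X - C ((u : L) / (v : L))) ^ (p - 1) * t.map S.subtype) * (X - C ((u : L) / (v : L))) := by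
            rw [h2]; ring
    rw [mul_right_cancel₀ hXb h3]
    exact Dvd.dvd.mul_right (dvd_pow_self _ hp1) _
  -- evaluate at `b`: `v * Ps(b) = 0`, so `ψ s = Ps(b) = 0`, i.e. `s ∈ ker ψ`
  have hPs0 : (Ps.map S.subtype).eval ((u : L) / (v : L)) = 0 := by
    obtain ⟨r, hr⟩ := hdiv
    have := congrArg (Polynomial.eval ((u : L) / (v : L))) hr
    simp only [eval_mul, eval_C, eval_sub, eval_X, sub_self, zero_mul] at this
    exact (mul_eq_zero.mp this).resolve_left hv'
  apply hsP
  rw [RingHom.mem_ker]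
  show AdjoinRoot.lift S.subtype _ heval (AdjoinRoot.mk _ Ps) = 0
  rw [AdjoinRoot.lift_mk, ← eval_map]
  exact hPs0

end NoRoot

end RadicandChainRealisation

end Summit.ResolutionOfSingularities.ResolutionOfSingularities.Theorems.SwitchingDichotomy

end
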